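import Summits.CriticalPhenomena.PercolationContinuityZ3.Theorems.PercNearOneGluingNoHeavyLowerTailCubicThreePointFibreEnum
import Mathlib.Data.Fin.VecNotation
import HarnessLib

/-!
# `NoHeavyLowerTail` (stmt-CriticalPhenomena-4575) — SHK3⁺ for every weighting of the THETA GRAPH (certificate, `native_decide`)

Support file (prover prim-sahi-p2; `--supports stmt-CriticalPhenomena-4575`; COMPUTATIONAL: the three finite checks are discharged by
`native_decide`).  The theta graph `Θ = K₂,₃ ∪ {34}` (terminals `0,1,2`, Steiner vertices `3,4`) is the smallest three-terminal graph
outside the terminal-series-parallel class `TSP` of `…GluingSeriesParallel` (its blocks are not glued at terminals or cut vertices), and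
every graph on five vertices is `Θ` plus terminal chords.  By the bitmask fibre criterion `shk3W_nonneg_of_fibM` (`…FibreEnum`), SHK3⁺
for ALL weights on `Θ` follows from: an injective edge numbering (`thetaIdx_inj`, `decide`), a correct cell table (`thetaSt_ok`: the 128
configurations, checked against decidable reachability), correct `PolZ` / submask tables (`polT_eq`, `subT_eq`), and a zero failure count over all
`4⁷` three-copy fibre sums (`theta_fail_zero`, `8⁷ ≈ 2·10⁶` consistent colourings, ≈ 20 s) — `theta_fib_nonneg`, `shk3W_theta_nonneg`.  The generic computable tables
(`stFin`, `mkTable`, `polTbl`) are heuristics validated exhaustively, never trusted.  This is the kernel form of the exact certificate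
"F is fibre-positive on Θ" of run/shared/lean/prim/prim-sahi/prim-sahi-p2/PROOF-E3.md §6 (lab/theta_bern.py; kit j071584).
[cite: Gladkov2024StrongFKG, Cor. 4.2 (the cubic row SHK3⁺ ⊇ AG)]
-/

namespace Summit.CriticalPhenomena.PercolationContinuityZ3.Theorems

namespace TerminalGluing

open Finset SimpleGraph Literature.Probability.Percolation Literature.Probability.Percolation.DecisionTree
open CubicThreePointStep CubicThreePointTerminal


/-! ### Computable tables for concrete graphs (validated exhaustively, never trusted) -/

section Cert

variable {W : Type*} [DecidableEq W] [Fintype W]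

/-- One closure step: add all vertices adjacent (through an edge of `S`) to the current set. [folklore] -/
def closStep (S : Finset (Sym2 W)) (C : Finset W) : Finset W :=
  C ∪ Finset.univ.filter (fun w => ∃ v ∈ C, s(v, w) ∈ S)

/-- The vertices reachable from `x` through edges of `S` (closure iterated `|W|` times). [folklore] -/
def compOf (S : Finset (Sym2 W)) (x : W) : Finset W := (closStep S)^[Fintype.card W] {x}

/-- A heuristic cell label of the configuration `S` for the terminals `(a,b,c)` (validated separately by `cellOK`). [folklore] -/
def stFin (a b c : W) (S : Finset (Sym2 W)) : Fin 5 :=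
  if b ∈ compOf S a then (if c ∈ compOf S a then 4 else 1)
  else if c ∈ compOf S a then 2 else if c ∈ compOf S b then 3 else 0

/-- The configuration encoded by a bitmask. [folklore] -/
def ofMask (D : Finset (Sym2 W)) (idx : Sym2 W → ℕ) (m : ℕ) : Finset (Sym2 W) := D.filter (fun e => m.testBit (idx e))

/-- The table of heuristic cell labels of all masks below `2^|D|`. [folklore] -/
def mkTable (D : Finset (Sym2 W)) (idx : Sym2 W → ℕ) (a b c : W) : Array (Fin 5) :=
  (Array.range (2 ^ D.card)).map (fun m => stFin a b c (ofMask D idx m))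

/-- The table of the 125 values of `PolZ`. [folklore] -/
def polTbl : Array ℤ :=
  (Array.range 125).map (fun i => PolZ (Fin.ofNat 5 (i / 25)) (Fin.ofNat 5 (i / 5)) (Fin.ofNat 5 i))

/-- `PolZ` read from the table. [folklore] -/
def polT : Fin 5 → Fin 5 → Fin 5 → ℤ := fun s₁ s₂ s₃ => polTbl.getD (s₁.val * 25 + s₂.val * 5 + s₃.val) 0

/-- The table is correct. [folklore] -/
theorem polT_eq : ∀ s₁ s₂ s₃ : Fin 5, polT s₁ s₂ s₃ = PolZ s₁ s₂ s₃ := by native_decide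

/-- The table of submask lists of the masks below `128` (graphs with ≤ 7 edges). [folklore] -/
def subTbl : Array (Multiset ℕ) := (Array.range 128).map submasks

/-- `submasks` read from the table. [folklore] -/
def subT : ℕ → Multiset ℕ := fun f => if f < subTbl.size then subTbl.getD f 0 else submasks f

/-- The table is correct. [folklore] -/
theorem subT_eq : ∀ f, subT f = submasks f := by
  have h : ∀ g ∈ Finset.range subTbl.size, subTbl.getD g 0 = submasks g := by native_decide
  intro f
  show (if f < subTbl.size then subTbl.getD f 0 else submasks f) = submasks f
  by_cases hf : f < subTbl.size
  · rw [if_pos hf]; exact h f (Finset.mem_range.mpr hf)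
  · rw [if_neg hf]

end Cert

/-! ### The theta graph `K₂,₃ + e` (terminals `0,1,2`; Steiner vertices `3,4` joined by an edge) -/

section Theta

/-- The seven edges of the theta graph `Θ = K₂,₃ ∪ {34}`. [folklore] -/
def thetaD : Finset (Sym2 (Fin 5)) := {s(0, 3), s(1, 3), s(2, 3), s(0, 4), s(1, 4), s(2, 4), s(3, 4)}

/-- Edge numbers of `Θ` (`{i,3} ↦ i`, `{i,4} ↦ 3+i` for `i < 3`, `{3,4} ↦ 6`; `7` = not an edge), arithmetically. [folklore] -/
def thetaF (i j : ℕ) : ℕ :=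
  if j = 3 then (if i = 4 then 6 else i) else if j = 4 then (if i = 3 then 6 else i + 3)
  else if i = 3 then j else if i = 4 then j + 3 else 7

/-- An edge numbering of `Θ`. [folklore] -/
def thetaIdx : Sym2 (Fin 5) → ℕ := Sym2.lift ⟨fun i j => thetaF i.val j.val, by decide⟩

/-- The cell table of `Θ`. [folklore] -/
def thetaTable : Array (Fin 5) := mkTable thetaD thetaIdx 0 1 2

/-- Cell labels of `Θ` configurations by mask. [folklore] -/
def thetaSt : ℕ → Fin 5 := fun m => thetaTable.getD m 0

/-- The numbering is injective on the edges. [folklore] -/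
theorem thetaIdx_inj : Set.InjOn thetaIdx ↑thetaD := by
  have h : ∀ x ∈ thetaD, ∀ y ∈ thetaD, thetaIdx x = thetaIdx y → x = y := by decide
  exact fun x hx y hy hxy => h x hx y hy hxy

/-- The cell table of `Θ` is correct (exhaustive check over the 128 configurations). [folklore] -/
theorem thetaSt_ok : ∀ S ∈ thetaD.powerset, cellOK (∅ : Finset (Sym2 (Fin 5))) 0 1 2 S (thetaSt (toMask thetaIdx S)) = true :=
  of_cellFailT (by native_decide)

/-- **The certificate**: no profile of `Θ` has a negative fibre sum (exhaustive: 4⁷ profiles, 8⁷ ≈ 2·10⁶ consistent colourings). [folklore] -/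
theorem theta_fail_zero : fibFailTP thetaD (fun _ _ _ => true) thetaIdx polTbl thetaTable subTbl = 0 := by
  native_decide

/-- **All 4⁷ three-copy fibre sums of `Θ` are nonnegative.** [folklore] -/
theorem theta_fib_nonneg :
    ∀ A₁ ∈ thetaD.powerset, ∀ A₂ ∈ A₁.powerset, ∀ A₃ ∈ A₂.powerset, 0 ≤ FibM thetaIdx polT thetaSt subT (A₁, A₂, A₃) :=
  fun A₁ h₁ A₂ h₂ A₃ h₃ => of_fibFailTP theta_fail_zero A₁ h₁ A₂ h₂ A₃ h₃ rfl

/-- **SHK3⁺ (Sahi's C₃ on the pairwise separations) for EVERY weighting of the theta graph** — the smallest graph outside the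
terminal-series-parallel class `TSP`. [folklore] -/
theorem shk3W_theta_nonneg (p : Sym2 (Fin 5) → ℝ) (hp0 : ∀ e, 0 ≤ p e) (hp1 : ∀ e, p e ≤ 1) :
    0 ≤ shk3W thetaD p ∅ (0 : Fin 5) 1 2 :=
  shk3W_nonneg_of_fibM thetaD ∅ 0 1 2 thetaIdx polT thetaSt subT p hp0 hp1 thetaIdx_inj polT_eq subT_eq thetaSt_ok theta_fib_nonneg

end Theta

end TerminalGluing

end Summit.CriticalPhenomena.PercolationContinuityZ3.Theorems
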